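import Mathlib.Analysis.Calculus.ParametricIntegral
import Mathlib.Analysis.Calculus.ContDiff.FiniteDimension
import Mathlib.Analysis.Calculus.FDeriv.Prod
import Mathlib.MeasureTheory.Integral.Bochner.ContinuousLinearMap
import Mathlib.Analysis.Normed.Group.Bounded
import Mathlib.Topology.MetricSpace.ProperSpace
import HarnessLib

/-!
# Smoothness of integrals against a smooth kernel evaluated along a bounded map

Topic `Literature/Analysis/Calculus` (the analytic input of Gårding's theorem "`π(f) φ` is a
smooth vector for `f ∈ C_c^∞`" in the form needed by
`Literature/NumberTheory/Automorphic/AutomorphicRepsGLCuspidalL2Step1.lean`, fact F1b;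
Getz–Hahn, *An Introduction to Automorphic Representations* (2024), Prop. 4.2.3; Bump,
*Automorphic Forms and Representations* (1997), (2.28)).

Let `E`, `M` be finite-dimensional real normed spaces, `A : E × M → ℂ` a `C^∞` function,
`(Ω, ν)` a measure space, `m : Ω → M` an a.e. strongly measurable map which is a.e. bounded,
and `F ∈ L¹(ν)`. Then

* `Literature.Analysis.Calculus.hasFDerivAt_integral_kernel_mul`: `X ↦ ∫ A (X, m y) F y dν`
  has derivative `∫ F y • (D A (X, m y) ∘ inl) dν` at every `X` (Mathlib's
  `hasFDerivAt_integral_of_dominated_of_fderiv_le`, the domination coming from continuity of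
  `D A` on the compact set `closedBall X 1 × closedBall 0 R`);
* `Literature.Analysis.Calculus.fderiv_integral_kernel_mul_apply`: the directional derivative
  formula `D(∫ A(·, m y) F y)(X) v = ∫ D A (X, m y) (v, 0) F y dν`;
* `Literature.Analysis.Calculus.contDiff_integral_kernel_mul`: `X ↦ ∫ A (X, m y) F y dν` is
  `C^∞` (induction on the order through `contDiff_succ_iff_fderiv_apply`, the derivative in the
  direction `v` being the same kind of integral with the smooth kernel `p ↦ D A p (v, 0)`).

Standard real analysis (differentiation under the integral sign; Dieudonné, *Foundations of
Modern Analysis* (1960), (8.11.2); Lang, *Real and Functional Analysis*, Ch. XIII §8); the tree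
has the interval-integral version with jointly smooth integrand
(`Literature.Analysis.Calculus.contDiff_intervalIntegral` of `HadamardLemma`) and a
convolution version (`Literature.Analysis.FluidPDE.contDiff_integral_smul_comp_sub` of
`HarmonicProbe`); here the measure space is arbitrary and only the kernel is smooth. [folklore]
-/

noncomputable section

open MeasureTheory Metric Set Filter Topology Function
open scoped ContDiff

namespace Literature.Analysis.Calculus

variable {E M : Type*} [NormedAddCommGroup E] [NormedSpace ℝ E] [FiniteDimensional ℝ E]
  [NormedAddCommGroup M] [NormedSpace ℝ M] [FiniteDimensional ℝ M]
  {Ω : Type*} [MeasurableSpace Ω] {ν : Measure Ω}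

/-- A continuous function on `E × M` is bounded on `closedBall X₀ r × closedBall 0 R`
(compactness in finite dimension). [folklore] -/
theorem exists_forall_norm_le_of_continuous_prod {G : Type*} [NormedAddCommGroup G]
    {g : E × M → G} (hg : Continuous g) (X₀ : E) (r R : ℝ) :
    ∃ C : ℝ, 0 ≤ C ∧ ∀ X ∈ closedBall X₀ r, ∀ y ∈ closedBall (0 : M) R, ‖g (X, y)‖ ≤ C := by
  have hK : IsCompact (closedBall X₀ r ×ˢ closedBall (0 : M) R) :=
    (isCompact_closedBall X₀ r).prod (isCompact_closedBall 0 R)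
  obtain ⟨C, hC⟩ := hK.exists_bound_of_continuousOn hg.continuousOn
  refine ⟨max C 0, le_max_right _ _, fun X hX y hy ↦ ?_⟩
  exact (hC (X, y) ⟨hX, hy⟩).trans (le_max_left _ _)

/-- The integrand `y ↦ A (X, m y) * F y` is integrable: `A (X, m y)` is a.e. bounded (continuity
of `A` on `{X} × closedBall 0 R`) and a.e. strongly measurable, `F ∈ L¹`. [folklore] -/
theorem integrable_kernel_mul {A : E × M → ℂ} (hA : Continuous A) {m : Ω → M}
    (hm : AEStronglyMeasurable m ν) {R : ℝ} (hmR : ∀ᵐ y ∂ν, ‖m y‖ ≤ R) {F : Ω → ℂ}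
    (hF : Integrable F ν) (X : E) : Integrable (fun y ↦ A (X, m y) * F y) ν := by
  obtain ⟨C, -, hC⟩ := exists_forall_norm_le_of_continuous_prod hA X 0 R
  refine hF.bdd_mul (c := C) (hA.comp_aestronglyMeasurable (aestronglyMeasurable_const.prodMk hm)) ?_
  filter_upwards [hmR] with y hy
  exact hC X (mem_closedBall_self le_rfl) (m y) (mem_closedBall_zero_iff.2 hy)

/-- **Differentiation under the integral sign for a smooth kernel.** For `A : E × M → ℂ` of class
`C¹` (here: `C^∞`), `m` a.e. bounded and `F ∈ L¹(ν)`, the function `X ↦ ∫ A (X, m y) F y dν` has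
derivative `∫ F y • (D A (X, m y) ∘ inl) dν` at `X`. Dieudonné (1960), (8.11.2). [folklore] -/
theorem hasFDerivAt_integral_kernel_mul {A : E × M → ℂ} (hA : ContDiff ℝ ∞ A) {m : Ω → M}
    (hm : AEStronglyMeasurable m ν) {R : ℝ} (hmR : ∀ᵐ y ∂ν, ‖m y‖ ≤ R) {F : Ω → ℂ}
    (hF : Integrable F ν) (X₀ : E) :
    Integrable (fun y ↦ F y • (fderiv ℝ A (X₀, m y)).comp (ContinuousLinearMap.inl ℝ E M)) ν ∧
    HasFDerivAt (fun X : E ↦ ∫ y, A (X, m y) * F y ∂ν)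
      (∫ y, F y • (fderiv ℝ A (X₀, m y)).comp (ContinuousLinearMap.inl ℝ E M) ∂ν) X₀ := by
  have hAc : Continuous A := hA.continuous
  have hA1 : Differentiable ℝ A := hA.differentiable (by simp)
  have hDAc : Continuous (fderiv ℝ A) := hA.continuous_fderiv (by simp)
  -- uniform bound for `D A` near `X₀`
  obtain ⟨C, hC0, hC⟩ := exists_forall_norm_le_of_continuous_prod hDAc X₀ 1 R
  -- the continuous linear map `L ↦ L ∘ inl`
  set cinl : (E × M →L[ℝ] ℂ) →L[ℝ] (E →L[ℝ] ℂ) :=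
    (ContinuousLinearMap.compL ℝ E (E × M) ℂ).flip (ContinuousLinearMap.inl ℝ E M) with hcinl
  have hcinl_apply : ∀ L : E × M →L[ℝ] ℂ, cinl L = L.comp (ContinuousLinearMap.inl ℝ E M) :=
    fun L ↦ rfl
  -- measurability of the kernel and of its derivative along `m`
  have hmeasA : ∀ X : E, AEStronglyMeasurable (fun y ↦ A (X, m y)) ν := fun X ↦
    hAc.comp_aestronglyMeasurable (aestronglyMeasurable_const.prodMk hm)
  have hmeasD : ∀ X : E, AEStronglyMeasurable
      (fun y ↦ (fderiv ℝ A (X, m y)).comp (ContinuousLinearMap.inl ℝ E M)) ν := by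
    intro X
    have h1 : AEStronglyMeasurable (fun y ↦ fderiv ℝ A (X, m y)) ν :=
      hDAc.comp_aestronglyMeasurable (aestronglyMeasurable_const.prodMk hm)
    simpa only [hcinl_apply] using cinl.continuous.comp_aestronglyMeasurable h1
  set F' : E → Ω → E →L[ℝ] ℂ := fun X y ↦
    F y • (fderiv ℝ A (X, m y)).comp (ContinuousLinearMap.inl ℝ E M) with hF'
  have hF'meas : ∀ X, AEStronglyMeasurable (F' X) ν := fun X ↦ hF.1.smul (hmeasD X)
  -- the bound
  have hbound : ∀ᵐ y ∂ν, ∀ X ∈ ball X₀ 1, ‖F' X y‖ ≤ C * ‖F y‖ := by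
    filter_upwards [hmR] with y hy X hX
    rw [hF']
    dsimp only
    refine (norm_smul_le (F y)
      ((fderiv ℝ A (X, m y)).comp (ContinuousLinearMap.inl ℝ E M))).trans ?_
    rw [mul_comm]
    refine mul_le_mul_of_nonneg_right ?_ (norm_nonneg _)
    refine (ContinuousLinearMap.opNorm_comp_le _ _).trans ?_
    have h1 : ‖fderiv ℝ A (X, m y)‖ ≤ C :=
      hC X (ball_subset_closedBall hX) (m y) (mem_closedBall_zero_iff.2 hy)
    calc ‖fderiv ℝ A (X, m y)‖ * ‖ContinuousLinearMap.inl ℝ E M‖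
        ≤ C * 1 := mul_le_mul h1 (ContinuousLinearMap.norm_inl_le_one ℝ E M) (norm_nonneg _) hC0
      _ = C := mul_one C
  have hbound_int : Integrable (fun y ↦ C * ‖F y‖) ν := hF.norm.const_mul C
  -- pointwise differentiability of the integrand
  have hdiff : ∀ᵐ y ∂ν, ∀ X ∈ ball X₀ 1,
      HasFDerivAt (fun X : E ↦ A (X, m y) * F y) (F' X y) X := by
    refine Eventually.of_forall fun y X _ ↦ ?_
    have h1 : HasFDerivAt (fun X : E ↦ A (X, m y))
        ((fderiv ℝ A (X, m y)).comp (ContinuousLinearMap.inl ℝ E M)) X :=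
      (hA1 (X, m y)).hasFDerivAt.comp X (hasFDerivAt_prodMk_left X (m y))
    simpa only [hF'] using h1.mul_const (F y)
  have hint₀ : Integrable (fun y ↦ A (X₀, m y) * F y) ν := integrable_kernel_mul hAc hm hmR hF X₀
  have key := hasFDerivAt_integral_of_dominated_of_fderiv_le (F' := F')
    (bound := fun y ↦ C * ‖F y‖) (ball_mem_nhds X₀ zero_lt_one)
    (Eventually.of_forall fun X ↦ (hmeasA X).mul hF.1) hint₀ (hF'meas X₀) hbound
    hbound_int hdiff
  refine ⟨?_, key⟩
  -- integrability of `F' X₀` from the bound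
  refine hbound_int.mono' (hF'meas X₀) ?_
  filter_upwards [hbound] with y hy
  exact hy X₀ (mem_ball_self zero_lt_one)

/-- **The directional derivative formula**: `D(X ↦ ∫ A (X, m y) F y dν)(X) v =
∫ D A (X, m y) (v, 0) F y dν`. Dieudonné (1960), (8.11.2). [folklore] -/
theorem fderiv_integral_kernel_mul_apply {A : E × M → ℂ} (hA : ContDiff ℝ ∞ A) {m : Ω → M}
    (hm : AEStronglyMeasurable m ν) {R : ℝ} (hmR : ∀ᵐ y ∂ν, ‖m y‖ ≤ R) {F : Ω → ℂ}
    (hF : Integrable F ν) (X : E) (v : E) :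
    fderiv ℝ (fun X : E ↦ ∫ y, A (X, m y) * F y ∂ν) X v =
      ∫ y, fderiv ℝ A (X, m y) (v, 0) * F y ∂ν := by
  obtain ⟨hint, hderiv⟩ := hasFDerivAt_integral_kernel_mul hA hm hmR hF X
  rw [hderiv.fderiv, ContinuousLinearMap.integral_apply hint v]
  refine integral_congr_ae (Eventually.of_forall fun y ↦ ?_)
  simp only [FunLike.coe_smul, Pi.smul_apply, ContinuousLinearMap.coe_comp,
    Function.comp_apply, ContinuousLinearMap.inl_apply, smul_eq_mul, mul_comm (F y)]

/-- **Smoothness of integrals against a smooth kernel.** Let `A : E × M → ℂ` be `C^∞` (`E`, `M`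
finite-dimensional), `m : Ω → M` a.e. strongly measurable and a.e. bounded, `F ∈ L¹(ν)`. Then
`X ↦ ∫ A (X, m y) F y dν` is `C^∞` on `E`. Proof: by induction on the finite order `k`, for all
kernels at once — differentiable with `D(∫ A F)(X) v = ∫ (D A (X, m y) (v, 0)) F y dν`
(`fderiv_integral_kernel_mul_apply`), an integral of the same shape with the `C^∞` kernel
`p ↦ D A p (v, 0)`, which is `C^{k}` by induction (`contDiff_succ_iff_fderiv_apply`, `E`
finite-dimensional). Dieudonné (1960), (8.11.2); Lang, *Real and Functional Analysis*, XIII §8.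
[folklore] -/
theorem contDiff_integral_kernel_mul {A : E × M → ℂ} (hA : ContDiff ℝ ∞ A) {m : Ω → M}
    (hm : AEStronglyMeasurable m ν) {R : ℝ} (hmR : ∀ᵐ y ∂ν, ‖m y‖ ≤ R) {F : Ω → ℂ}
    (hF : Integrable F ν) :
    ContDiff ℝ ∞ (fun X : E ↦ ∫ y, A (X, m y) * F y ∂ν) := by
  have key : ∀ (k : ℕ) (A : E × M → ℂ), ContDiff ℝ ∞ A →
      ContDiff ℝ k (fun X : E ↦ ∫ y, A (X, m y) * F y ∂ν) := by
    intro k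
    induction k with
    | zero =>
      intro A hA
      exact contDiff_zero.2 (continuous_iff_continuousAt.2 fun X ↦
        (hasFDerivAt_integral_kernel_mul hA hm hmR hF X).2.continuousAt)
    | succ k ih =>
      intro A hA
      rw [show ((k + 1 : ℕ) : WithTop ℕ∞) = (k : WithTop ℕ∞) + 1 by push_cast; rfl,
        contDiff_succ_iff_fderiv_apply]
      refine ⟨fun X ↦ (hasFDerivAt_integral_kernel_mul hA hm hmR hF X).2.differentiableAt,
        fun h ↦ absurd h (by exact_mod_cast WithTop.natCast_ne_top k), fun v ↦ ?_⟩
      have heq : (fun X ↦ fderiv ℝ (fun X : E ↦ ∫ y, A (X, m y) * F y ∂ν) X v) =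
          fun X ↦ ∫ y, (fun p : E × M ↦ fderiv ℝ A p (v, 0)) (X, m y) * F y ∂ν :=
        funext fun X ↦ fderiv_integral_kernel_mul_apply hA hm hmR hF X v
      rw [heq]
      exact ih _ ((hA.fderiv_right le_rfl).clm_apply contDiff_const)
  exact contDiff_infty.2 fun k ↦ key k A hA

end Literature.Analysis.Calculus
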